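import Literature.Analysis.FluidPDE.DriftHeatKernel
import Mathlib.Analysis.SpecialFunctions.Pow.Asymptotics
import HarnessLib

/-!
# Explicit Gaussian bounds and small-time asymptotics of the drift-robust heat kernels

Analysis/FluidPDE support file for the proof of the named fact
`Literature.Analysis.FluidPDE.KNSS2009_lemma21` (KNSS 2009, Lemma 2.1 as printed). The comparison
arguments with the kernel barriers of `DriftHeatKernelBarrier` need the values of the kernels
`k_ε = driftKernel ε A` (`ε = ±1`) on and off a ball, as explicit functions of the age `σ`:

* `gaussTail n d σ = (4πσ)^{-n/2} e^{-d²/(4σ)}` — the value of the heat kernel on the sphere of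
  radius `d`, an upper bound of `k₋ ≤ heatKernel` on `‖y‖ ≥ d` (`driftKernel_le_gaussTail`);
  its `σ`-derivative `gaussTailDt` is nonnegative as long as `2nσ ≤ d²`
  (`gaussTailDt_nonneg`: the tail value grows with the age before the bulk arrives), which is
  what makes `t ↦ (∫h) gaussTail(t − s + σ₀)` an admissible (nondecreasing) correction of a
  subsolution;
* `kSubLow n A D σ` — a lower bound of `k_ε` on `‖y‖ ≤ D` (`kSubLow_le_driftKernel`);
* `kSupMax n A R σ`, `kSupTail n A R σ` — upper bounds of `k_ε` on `‖y‖ ≤ R`, resp. `‖y‖ ≥ R`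
  (`driftKernel_le_kSupMax`, `driftKernel_le_kSupTail`);
* the small-time limits used to choose the parameters of Lemma 2.1:
  `kSupTail → 0` and `gaussTail d / kSubLow D → 0` (`d > D`) as `σ → 0⁺`
  (`tendsto_kSupTail_nhdsGT_zero`, `tendsto_gaussTail_div_kSubLow_nhdsGT_zero`), from
  `σ^{-p} e^{-c/σ} → 0`.

## References

* L. C. Evans, *Partial Differential Equations*, 2nd ed. (2010), §2.3.1 (the heat kernel).
  [Evans2010]
* G. Koch, N. Nadirashvili, G. Seregin, V. Šverák, *Liouville theorems for the Navier–Stokes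
  equations and applications*, Acta Math. 203 (2009) = arXiv:0709.3599, Lemma 2.1 (p. 5).
  [KochNadirashviliSereginSverak2009]
-/

noncomputable section

open Real Set Filter Topology InnerProductSpace Function Metric
open scoped RealInnerProductSpace

namespace Literature.Analysis.FluidPDE

/-! ### The explicit functions of the age -/

/-- `(4πσ)^{-n/2} e^{-d²/(4σ)}`: the heat kernel at distance `d`, age `σ`. [folklore] -/
def gaussTail (n d σ : ℝ) : ℝ := (4 * π * σ) ^ (-n / 2) * exp (-d ^ 2 / (4 * σ))

/-- `σ`-derivative of `gaussTail n d`: `gaussTail · (−n/(2σ) + d²/(4σ²))`. [folklore] -/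
def gaussTailDt (n d σ : ℝ) : ℝ := gaussTail n d σ * (-n / (2 * σ) + d ^ 2 / (4 * σ ^ 2))

/-- The tilt size `A√(D² + σ) + 2(n+1)A√σ + 2A²σ` of the drift-robust kernels at radius `D`.
[folklore] -/
def dkTilt (n A D σ : ℝ) : ℝ := A * √(D ^ 2 + σ) + 2 * (n + 1) * A * √σ + 2 * A ^ 2 * σ

/-- Lower bound of `k_ε(σ, y)` on `‖y‖ ≤ D`: `(4πσ)^{-n/2} e^{-D²/(4σ)} e^{-dkTilt}`. [folklore] -/
def kSubLow (n A D σ : ℝ) : ℝ :=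
  (4 * π * σ) ^ (-n / 2) * exp (-D ^ 2 / (4 * σ)) * exp (-dkTilt n A D σ)

/-- Upper bound of `k_ε(σ, y)` on `‖y‖ ≤ R`: `(4πσ)^{-n/2} e^{dkTilt}`. [folklore] -/
def kSupMax (n A R σ : ℝ) : ℝ := (4 * π * σ) ^ (-n / 2) * exp (dkTilt n A R σ)

/-- Upper bound of `k_ε(σ, y)` on `‖y‖ ≥ R`:
`(4πσ)^{-n/2} e^{-R²/(8σ)} e^{2A²σ + A√σ + 2(n+1)A√σ + 2A²σ}`. [folklore] -/
def kSupTail (n A R σ : ℝ) : ℝ :=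
  (4 * π * σ) ^ (-n / 2) * exp (-R ^ 2 / (8 * σ)) *
    exp (2 * A ^ 2 * σ + A * √σ + (2 * (n + 1) * A * √σ + 2 * A ^ 2 * σ))

/-! ### Positivity, continuity, derivative -/

/-- `gaussTail` is positive for `σ > 0`. [folklore] -/
theorem gaussTail_pos (n d : ℝ) {σ : ℝ} (hσ : 0 < σ) : 0 < gaussTail n d σ := by
  unfold gaussTail; exact mul_pos (rpow_pos_of_pos (by positivity) _) (exp_pos _)

/-- `kSubLow` is positive for `σ > 0`. [folklore] -/
theorem kSubLow_pos (n A D : ℝ) {σ : ℝ} (hσ : 0 < σ) : 0 < kSubLow n A D σ := by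
  unfold kSubLow
  exact mul_pos (mul_pos (rpow_pos_of_pos (by positivity) _) (exp_pos _)) (exp_pos _)

/-- `kSupMax` is positive for `σ > 0`. [folklore] -/
theorem kSupMax_pos (n A R : ℝ) {σ : ℝ} (hσ : 0 < σ) : 0 < kSupMax n A R σ := by
  unfold kSupMax; exact mul_pos (rpow_pos_of_pos (by positivity) _) (exp_pos _)

/-- `kSupTail` is nonnegative for `σ > 0`. [folklore] -/
theorem kSupTail_nonneg (n A R : ℝ) {σ : ℝ} (hσ : 0 < σ) : 0 ≤ kSupTail n A R σ := by
  unfold kSupTail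
  exact (mul_pos (mul_pos (rpow_pos_of_pos (by positivity) _) (exp_pos _)) (exp_pos _)).le

/-- The tilt size is nonnegative. [folklore] -/
theorem dkTilt_nonneg {n A D σ : ℝ} (hn : 0 ≤ n) (hA : 0 ≤ A) (hσ : 0 ≤ σ) :
    0 ≤ dkTilt n A D σ := by
  unfold dkTilt; positivity

/-- Continuity of the normalisation `σ ↦ (4πσ)^{-n/2}` on `(0, ∞)`. [folklore] -/
theorem continuousOn_heatNorm (n : ℝ) :
    ContinuousOn (fun σ : ℝ => (4 * π * σ) ^ (-n / 2)) (Ioi 0) :=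
  ContinuousOn.rpow_const (by fun_prop) fun σ hσ => Or.inl (by
    have : (0 : ℝ) < σ := hσ
    positivity)

/-- Continuity of the tilt size on `(0, ∞)`. [folklore] -/
theorem continuousOn_dkTilt (n A D : ℝ) : ContinuousOn (dkTilt n A D) (Ioi 0) := by
  unfold dkTilt; fun_prop

/-- Continuity of `gaussTail` on `(0, ∞)`. [folklore] -/
theorem continuousOn_gaussTail (n d : ℝ) : ContinuousOn (gaussTail n d) (Ioi 0) := by
  unfold gaussTail
  refine (continuousOn_heatNorm n).mul (ContinuousOn.rexp ?_)
  exact ContinuousOn.div continuousOn_const (by fun_prop) fun σ hσ => by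
    have : (0 : ℝ) < σ := hσ
    positivity

/-- Continuity of `gaussTailDt` on `(0, ∞)`. [folklore] -/
theorem continuousOn_gaussTailDt (n d : ℝ) : ContinuousOn (gaussTailDt n d) (Ioi 0) := by
  unfold gaussTailDt
  refine (continuousOn_gaussTail n d).mul (ContinuousOn.add ?_ ?_)
  · exact ContinuousOn.div continuousOn_const (by fun_prop) fun σ hσ => by
      have : (0 : ℝ) < σ := hσ
      positivity
  · exact ContinuousOn.div continuousOn_const (by fun_prop) fun σ hσ => by
      have : (0 : ℝ) < σ := hσ
      positivity

/-- Continuity of `kSubLow` on `(0, ∞)`. [folklore] -/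
theorem continuousOn_kSubLow (n A D : ℝ) : ContinuousOn (kSubLow n A D) (Ioi 0) := by
  unfold kSubLow
  refine ((continuousOn_heatNorm n).mul (ContinuousOn.rexp ?_)).mul
    (continuousOn_dkTilt n A D).neg.rexp
  exact ContinuousOn.div continuousOn_const (by fun_prop) fun σ hσ => by
    have : (0 : ℝ) < σ := hσ
    positivity

/-- Continuity of `kSupMax` on `(0, ∞)`. [folklore] -/
theorem continuousOn_kSupMax (n A R : ℝ) : ContinuousOn (kSupMax n A R) (Ioi 0) := by
  unfold kSupMax
  exact (continuousOn_heatNorm n).mul (continuousOn_dkTilt n A R).rexp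

/-- Continuity of `kSupTail` on `(0, ∞)`. [folklore] -/
theorem continuousOn_kSupTail (n A R : ℝ) : ContinuousOn (kSupTail n A R) (Ioi 0) := by
  unfold kSupTail
  refine ((continuousOn_heatNorm n).mul (ContinuousOn.rexp ?_)).mul (Continuous.continuousOn ?_)
  · exact ContinuousOn.div continuousOn_const (by fun_prop) fun σ hσ => by
      have : (0 : ℝ) < σ := hσ
      positivity
  · fun_prop

/-- `∂_σ gaussTail = gaussTailDt` for `σ > 0`. [folklore] -/
theorem hasDerivAt_gaussTail (n d : ℝ) {σ : ℝ} (hσ : 0 < σ) :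
    HasDerivAt (gaussTail n d) (gaussTailDt n d σ) σ := by
  have h4π : (0 : ℝ) < 4 * π * σ := by positivity
  have hN : HasDerivAt (fun σ' : ℝ => (4 * π * σ') ^ (-n / 2))
      ((4 * π * σ) ^ (-n / 2) * (-n / (2 * σ))) σ := by
    have h1 : HasDerivAt (fun σ' : ℝ => 4 * π * σ') (4 * π) σ := by
      simpa using (hasDerivAt_id σ).const_mul (4 * π)
    refine (h1.rpow_const (p := -n / 2) (Or.inl h4π.ne')).congr_deriv ?_
    rw [rpow_sub_one h4π.ne']
    field_simp
  have hE : HasDerivAt (fun σ' : ℝ => exp (-d ^ 2 / (4 * σ')))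
      (exp (-d ^ 2 / (4 * σ)) * (d ^ 2 / (4 * σ ^ 2))) σ := by
    have e1 : HasDerivAt (fun σ' : ℝ => -d ^ 2 / 4 * σ'⁻¹) (-d ^ 2 / 4 * (-(σ ^ 2)⁻¹)) σ :=
      (hasDerivAt_inv hσ.ne').const_mul _
    have hfun : (fun σ' : ℝ => exp (-d ^ 2 / (4 * σ'))) =
        fun σ' => exp (-d ^ 2 / 4 * σ'⁻¹) := by
      funext σ'; congr 1; ring
    rw [hfun]
    refine e1.exp.congr_deriv ?_
    rw [show -d ^ 2 / 4 * σ⁻¹ = -d ^ 2 / (4 * σ) by ring]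
    field_simp
  refine (hN.mul hE).congr_deriv ?_
  simp only [gaussTailDt, gaussTail]
  ring

/-- Before the bulk arrives the tail value grows: `∂_σ gaussTail ≥ 0` if `2 n σ ≤ d²`.
[folklore] -/
theorem gaussTailDt_nonneg {n d σ : ℝ} (hσ : 0 < σ) (h : 2 * n * σ ≤ d ^ 2) :
    0 ≤ gaussTailDt n d σ := by
  unfold gaussTailDt
  refine mul_nonneg (gaussTail_pos n d hσ).le ?_
  have : -n / (2 * σ) + d ^ 2 / (4 * σ ^ 2) = (d ^ 2 - 2 * n * σ) / (4 * σ ^ 2) := by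
    field_simp
    ring
  rw [this]
  exact div_nonneg (by linarith) (by positivity)

/-! ### The kernel bounds -/

section Kernel

variable {E : Type*} [NormedAddCommGroup E] [InnerProductSpace ℝ E]

/-- Off the ball of radius `d` the heat kernel is at most its value on the sphere:
`heatKernel σ y ≤ gaussTail n d σ` for `d ≤ ‖y‖`. [folklore] -/
theorem heatKernel_le_gaussTail {σ : ℝ} (hσ : 0 < σ) {d : ℝ} (hd : 0 ≤ d) {y : E}
    (hy : d ≤ ‖y‖) :
    UnboundedOperators.heatKernel σ y ≤ gaussTail (Module.finrank ℝ E) d σ := by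
  rw [UnboundedOperators.heatKernel_eq, gaussTail]
  have h4 : (0 : ℝ) < 4 * σ := by positivity
  refine mul_le_mul_of_nonneg_left (exp_le_exp.2 ?_)
    (rpow_nonneg (by positivity : (0 : ℝ) ≤ 4 * π * σ) _)
  rw [show -(1 / (4 * σ)) * ‖y‖ ^ 2 = -‖y‖ ^ 2 / (4 * σ) by field_simp]
  exact div_le_div_of_nonneg_right (by nlinarith [pow_le_pow_left₀ hd hy 2]) h4.le

/-- On the ball of radius `D` the heat kernel is at least its value on the sphere. [folklore] -/
theorem gaussTail_le_heatKernel {σ : ℝ} (hσ : 0 < σ) {D : ℝ} {y : E} (hy : ‖y‖ ≤ D) :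
    gaussTail (Module.finrank ℝ E) D σ ≤ UnboundedOperators.heatKernel σ y := by
  rw [UnboundedOperators.heatKernel_eq, gaussTail]
  have h4 : (0 : ℝ) < 4 * σ := by positivity
  refine mul_le_mul_of_nonneg_left (exp_le_exp.2 ?_)
    (rpow_nonneg (by positivity : (0 : ℝ) ≤ 4 * π * σ) _)
  rw [show -(1 / (4 * σ)) * ‖y‖ ^ 2 = -‖y‖ ^ 2 / (4 * σ) by field_simp]
  exact div_le_div_of_nonneg_right (by nlinarith [pow_le_pow_left₀ (norm_nonneg y) hy 2]) h4.le

/-- **Off-ball bound for the kernels with `ε ≤ 0`** (in particular the subsolution kernel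
`k₋`): `k_ε(σ, y) ≤ heatKernel σ y ≤ gaussTail n d σ` for `d ≤ ‖y‖`, `−1 ≤ ε ≤ 0`, `A ≥ 0`.
[folklore] -/
theorem driftKernel_le_gaussTail {ε A σ : ℝ} (hε : ε ∈ Icc (-1 : ℝ) 0) (hA : 0 ≤ A)
    (hσ : 0 < σ) {d : ℝ} (hd : 0 ≤ d) {y : E} (hy : d ≤ ‖y‖) :
    driftKernel ε A σ y ≤ gaussTail (Module.finrank ℝ E) d σ := by
  refine le_trans ?_ (heatKernel_le_gaussTail hσ hd hy)
  rw [driftKernel_eq_heatKernel_mul]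
  refine mul_le_of_le_one_right (UnboundedOperators.heatKernel_pos hσ y).le ?_
  rw [exp_le_one_iff]
  have hg := driftKernel_tilt_nonneg (E := E) hA hσ.le y
  nlinarith [hε.1, hε.2]

/-- **In-ball lower bound**: `kSubLow n A D σ ≤ k_ε(σ, y)` for `‖y‖ ≤ D`, `|ε| ≤ 1`, `A ≥ 0`.
[folklore] -/
theorem kSubLow_le_driftKernel {ε A σ : ℝ} (hε : |ε| ≤ 1) (hA : 0 ≤ A) (hσ : 0 < σ)
    {D : ℝ} {y : E} (hy : ‖y‖ ≤ D) :
    kSubLow (Module.finrank ℝ E) A D σ ≤ driftKernel ε A σ y := by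
  refine le_trans ?_ (le_driftKernel hε hA hσ y)
  rw [kSubLow]
  refine mul_le_mul (gaussTail_le_heatKernel hσ hy) (exp_le_exp.2 ?_) (exp_pos _).le
    (UnboundedOperators.heatKernel_pos hσ y).le
  rw [dkTilt, neg_le_neg_iff]
  have hD : 0 ≤ D := (norm_nonneg y).trans hy
  have h1 : √(‖y‖ ^ 2 + σ) ≤ √(D ^ 2 + σ) :=
    sqrt_le_sqrt (by nlinarith [pow_le_pow_left₀ (norm_nonneg y) hy 2])
  nlinarith [mul_le_mul_of_nonneg_left h1 hA]

/-- **In-ball upper bound**: `k_ε(σ, y) ≤ kSupMax n A R σ` for `‖y‖ ≤ R`, `|ε| ≤ 1`, `A ≥ 0`.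
[folklore] -/
theorem driftKernel_le_kSupMax {ε A σ : ℝ} (hε : |ε| ≤ 1) (hA : 0 ≤ A) (hσ : 0 < σ)
    {R : ℝ} {y : E} (hy : ‖y‖ ≤ R) :
    driftKernel ε A σ y ≤ kSupMax (Module.finrank ℝ E) A R σ := by
  refine (driftKernel_le hε hA hσ y).trans ?_
  rw [kSupMax]
  refine mul_le_mul (UnboundedOperators.heatKernel_le hσ y) (exp_le_exp.2 ?_) (exp_pos _).le
    (rpow_nonneg (by positivity : (0 : ℝ) ≤ 4 * π * σ) _)
  rw [dkTilt]
  have h1 : √(‖y‖ ^ 2 + σ) ≤ √(R ^ 2 + σ) :=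
    sqrt_le_sqrt (by nlinarith [pow_le_pow_left₀ (norm_nonneg y) hy 2])
  nlinarith [mul_le_mul_of_nonneg_left h1 hA]

/-- **Off-ball upper bound**: `k_ε(σ, y) ≤ kSupTail n A R σ` for `R ≤ ‖y‖`, `|ε| ≤ 1`,
`A ≥ 0` (`√(‖y‖²+σ) ≤ ‖y‖ + √σ` and `A‖y‖ ≤ ‖y‖²/(8σ) + 2A²σ`). [folklore] -/
theorem driftKernel_le_kSupTail {ε A σ : ℝ} (hε : |ε| ≤ 1) (hA : 0 ≤ A) (hσ : 0 < σ)
    {R : ℝ} (hR : 0 ≤ R) {y : E} (hy : R ≤ ‖y‖) :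
    driftKernel ε A σ y ≤ kSupTail (Module.finrank ℝ E) A R σ := by
  refine (driftKernel_le hε hA hσ y).trans ?_
  set n : ℝ := (Module.finrank ℝ E : ℝ) with hn
  have hsq : √(‖y‖ ^ 2 + σ) ≤ ‖y‖ + √σ := by
    rw [sqrt_le_left (by positivity)]
    nlinarith [sq_sqrt hσ.le, norm_nonneg y, sqrt_nonneg σ]
  have h8 : (0 : ℝ) < 8 * σ := by positivity
  have hAM : A * ‖y‖ ≤ ‖y‖ ^ 2 / (8 * σ) + 2 * A ^ 2 * σ := by
    have key : 0 ≤ (‖y‖ - 4 * A * σ) ^ 2 := sq_nonneg _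
    rw [div_add' _ _ _ h8.ne', le_div_iff₀ h8]
    nlinarith
  have hR2 : R ^ 2 ≤ ‖y‖ ^ 2 := pow_le_pow_left₀ hR hy 2
  have e1 : -(1 / (4 * σ)) * ‖y‖ ^ 2 = -(‖y‖ ^ 2 / (8 * σ)) - ‖y‖ ^ 2 / (8 * σ) := by
    field_simp
    ring
  have e2 : -(‖y‖ ^ 2 / (8 * σ)) ≤ -R ^ 2 / (8 * σ) := by
    rw [neg_div, neg_le_neg_iff]
    exact div_le_div_of_nonneg_right hR2 h8.le
  have key : exp (-(1 / (4 * σ)) * ‖y‖ ^ 2) *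
      exp (A * √(‖y‖ ^ 2 + σ) + 2 * (n + 1) * A * √σ + 2 * A ^ 2 * σ) ≤
      exp (-R ^ 2 / (8 * σ)) * exp (2 * A ^ 2 * σ + A * √σ + (2 * (n + 1) * A * √σ +
        2 * A ^ 2 * σ)) := by
    rw [← exp_add, ← exp_add]
    exact exp_le_exp.2 (by nlinarith [mul_le_mul_of_nonneg_left hsq hA, e2])
  have hc : (0 : ℝ) ≤ (4 * π * σ) ^ (-n / 2) := rpow_nonneg (by positivity) _
  rw [kSupTail, UnboundedOperators.heatKernel_eq, ← hn]
  calc (4 * π * σ) ^ (-n / 2) * exp (-(1 / (4 * σ)) * ‖y‖ ^ 2) *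
        exp (A * √(‖y‖ ^ 2 + σ) + 2 * (n + 1) * A * √σ + 2 * A ^ 2 * σ)
      = (4 * π * σ) ^ (-n / 2) * (exp (-(1 / (4 * σ)) * ‖y‖ ^ 2) *
          exp (A * √(‖y‖ ^ 2 + σ) + 2 * (n + 1) * A * √σ + 2 * A ^ 2 * σ)) := by ring
    _ ≤ (4 * π * σ) ^ (-n / 2) * (exp (-R ^ 2 / (8 * σ)) * exp (2 * A ^ 2 * σ + A * √σ +
          (2 * (n + 1) * A * √σ + 2 * A ^ 2 * σ))) := mul_le_mul_of_nonneg_left key hc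
    _ = _ := by ring

end Kernel

/-! ### Small-time asymptotics -/

/-- `σ ↦ σ^{-p} e^{-c/σ} → 0` as `σ → 0⁺` (`c > 0`). [folklore] -/
theorem tendsto_rpow_neg_mul_exp_neg_div_nhdsGT_zero (p : ℝ) {c : ℝ} (hc : 0 < c) :
    Tendsto (fun σ : ℝ => σ ^ (-p) * exp (-c / σ)) (𝓝[>] 0) (𝓝 0) := by
  have h := (tendsto_rpow_mul_exp_neg_mul_atTop_nhds_zero p c hc).comp tendsto_inv_nhdsGT_zero
  refine h.congr' ?_
  filter_upwards [self_mem_nhdsWithin] with σ hσ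
  have hσ' : (0 : ℝ) < σ := hσ
  simp only [comp_apply]
  rw [rpow_neg hσ'.le, ← inv_rpow hσ'.le, div_eq_mul_inv]

/-- The normalisation as a power of `σ`: `(4πσ)^{-n/2} = (4π)^{-n/2} σ^{-(n/2)}`. [folklore] -/
theorem heatNorm_eq (n : ℝ) {σ : ℝ} (hσ : 0 ≤ σ) :
    (4 * π * σ) ^ (-n / 2) = (4 * π) ^ (-n / 2) * σ ^ (-(n / 2)) := by
  rw [mul_rpow (by positivity) hσ, neg_div]

/-- `e^{-c/σ} → 0` as `σ → 0⁺` (`c > 0`). [folklore] -/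
theorem tendsto_exp_neg_div_nhdsGT_zero {c : ℝ} (hc : 0 < c) :
    Tendsto (fun σ : ℝ => exp (-c / σ)) (𝓝[>] 0) (𝓝 0) := by
  refine (tendsto_rpow_neg_mul_exp_neg_div_nhdsGT_zero 0 hc).congr' ?_
  filter_upwards [self_mem_nhdsWithin] with σ _
  rw [neg_zero, rpow_zero, one_mul]

/-- **The off-ball bound vanishes at small age**: `kSupTail n A R σ → 0` as `σ → 0⁺`
(`R > 0`). [folklore] -/
theorem tendsto_kSupTail_nhdsGT_zero (n A : ℝ) {R : ℝ} (hR : 0 < R) :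
    Tendsto (kSupTail n A R) (𝓝[>] 0) (𝓝 0) := by
  have h1 := tendsto_rpow_neg_mul_exp_neg_div_nhdsGT_zero (n / 2) (c := R ^ 2 / 8)
    (by positivity)
  have hB : Tendsto (fun σ : ℝ => exp (2 * A ^ 2 * σ + A * √σ +
      (2 * (n + 1) * A * √σ + 2 * A ^ 2 * σ))) (𝓝[>] 0) (𝓝 1) := by
    have hc : Continuous fun σ : ℝ => exp (2 * A ^ 2 * σ + A * √σ +
        (2 * (n + 1) * A * √σ + 2 * A ^ 2 * σ)) := by fun_prop
    have h := hc.tendsto 0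
    simp only [sqrt_zero, mul_zero, add_zero, exp_zero] at h
    exact h.mono_left nhdsWithin_le_nhds
  have h := (h1.const_mul ((4 * π) ^ (-n / 2))).mul hB
  rw [mul_zero, zero_mul] at h
  refine h.congr' ?_
  filter_upwards [self_mem_nhdsWithin] with σ hσ
  have hσ' : (0 : ℝ) < σ := hσ
  have e1 : -(R ^ 2 / 8) / σ = -R ^ 2 / (8 * σ) := by field_simp
  rw [kSupTail, heatNorm_eq n hσ'.le, e1]
  ring

/-- **The tail/bulk ratio vanishes at small age**:
`gaussTail n d σ / kSubLow n A D σ → 0` as `σ → 0⁺` when `0 ≤ D < d`. [folklore] -/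
theorem tendsto_gaussTail_div_kSubLow_nhdsGT_zero (n A : ℝ) {d D : ℝ} (hD : 0 ≤ D)
    (hdD : D < d) :
    Tendsto (fun σ : ℝ => gaussTail n d σ / kSubLow n A D σ) (𝓝[>] 0) (𝓝 0) := by
  have hc : 0 < (d ^ 2 - D ^ 2) / 4 := by
    have : D ^ 2 < d ^ 2 := by nlinarith
    linarith
  have h1 := tendsto_exp_neg_div_nhdsGT_zero hc
  have hT : Tendsto (fun σ : ℝ => exp (dkTilt n A D σ)) (𝓝[>] 0) (𝓝 (exp (dkTilt n A D 0))) := by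
    have hcont : Continuous fun σ : ℝ => exp (dkTilt n A D σ) := by unfold dkTilt; fun_prop
    exact (hcont.tendsto 0).mono_left nhdsWithin_le_nhds
  have h := h1.mul hT
  rw [zero_mul] at h
  refine h.congr' ?_
  filter_upwards [self_mem_nhdsWithin] with σ hσ
  have hσ' : (0 : ℝ) < σ := hσ
  rw [eq_div_iff (kSubLow_pos n A D hσ').ne', kSubLow, gaussTail]
  have key : exp (-((d ^ 2 - D ^ 2) / 4) / σ) * exp (dkTilt n A D σ) *
      (exp (-D ^ 2 / (4 * σ)) * exp (-dkTilt n A D σ)) = exp (-d ^ 2 / (4 * σ)) := by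
    rw [← exp_add, ← exp_add, ← exp_add]
    congr 1
    field_simp
    ring
  calc exp (-((d ^ 2 - D ^ 2) / 4) / σ) * exp (dkTilt n A D σ) *
        ((4 * π * σ) ^ (-n / 2) * exp (-D ^ 2 / (4 * σ)) * exp (-dkTilt n A D σ))
      = (4 * π * σ) ^ (-n / 2) * (exp (-((d ^ 2 - D ^ 2) / 4) / σ) * exp (dkTilt n A D σ) *
          (exp (-D ^ 2 / (4 * σ)) * exp (-dkTilt n A D σ))) := by ring
    _ = (4 * π * σ) ^ (-n / 2) * exp (-d ^ 2 / (4 * σ)) := by rw [key]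

/-- **Eventual form of the small-time limits**, as used to fix the parameters of Lemma 2.1:
for `0 ≤ D < d` and `R > 0`, for all sufficiently small `σ > 0` one has
`gaussTail n d σ < kSubLow n A D σ / 2`, `2 n σ < d²` and `kSupTail n A R σ < η` (`η > 0`).
[folklore] -/
theorem eventually_small_age (n A : ℝ) {d D R η : ℝ} (hD : 0 ≤ D) (hdD : D < d) (hR : 0 < R)
    (hη : 0 < η) :
    ∀ᶠ σ in 𝓝[>] (0 : ℝ), gaussTail n d σ < kSubLow n A D σ / 2 ∧ 2 * n * σ < d ^ 2 ∧
      kSupTail n A R σ < η := by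
  have hd2 : 0 < d ^ 2 := by
    have : 0 < d := lt_of_le_of_lt hD hdD
    positivity
  have h1 := (tendsto_gaussTail_div_kSubLow_nhdsGT_zero n A hD hdD).eventually
    (gt_mem_nhds (by norm_num : (0 : ℝ) < 1 / 2))
  have h2 : ∀ᶠ σ in 𝓝[>] (0 : ℝ), 2 * n * σ < d ^ 2 := by
    have hc : Continuous fun σ : ℝ => 2 * n * σ := by fun_prop
    have ht := (hc.tendsto 0).mono_left (nhdsWithin_le_nhds (s := Ioi (0 : ℝ)))
    simp only [mul_zero] at ht
    exact ht.eventually (gt_mem_nhds hd2)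
  have h3 := (tendsto_kSupTail_nhdsGT_zero n A hR).eventually (gt_mem_nhds hη)
  filter_upwards [h1, h2, h3, self_mem_nhdsWithin] with σ hσ1 hσ2 hσ3 hσ
  refine ⟨?_, hσ2, hσ3⟩
  have hk := kSubLow_pos n A D (show (0 : ℝ) < σ from hσ)
  rw [div_lt_iff₀ hk] at hσ1
  linarith

end Literature.Analysis.FluidPDE

end
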